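import Literature.Geometry.Riemannian.PinchingEstimatesSingularCore
import Literature.Geometry.Riemannian.PinchingEstimatesLargest
import Mathlib.Analysis.SpecialFunctions.Sqrt
import HarnessLib

/-!
# Hamilton 1997, Thm. 1.9 at the level of the curvature ODE — proved
(topic `Geometry/Riemannian`)

Part of the decomposition of `Literature.Geometry.Riemannian.hamilton_chenZhu_pinching`
(`PinchingEstimates.lean`). Hamilton 1997, §2.1, Thm. 1.9 (pp. 12–13): under `a₁ + ρ > 0`,
`c₁ + ρ > 0`, `max(a₃, b₃, c₃) ≤ Ω(a₁ + ρ)` and `≤ Ω(c₁ + ρ)`, "for any constant `H > 0` the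
inequality `b₃ ≤ H e^{Pt} √((a₁ + ρ)(c₁ + ρ))` is preserved by the Ricci flow with `P = 4Ωρ`."
PROVED here at the ODE level, in the shape of the Thm. 1.9 hypothesis of
`hamilton_chenZhu_pinching_of_ode₆` (`PinchingEstimatesReduction2.lean`):

* `hamilton1997_B19_ode` — for `0 < m, ρ, Ω, H` and `4Ωρ ≤ P`, the time-dependent family
  `{(A, B, C) | SingularValueLEExp (A, B, C) H P ρ t}` is forward invariant under Hamilton's ODE
  relative to `{A, C symmetric} ∩ {a₁ + a₂ ≥ m} ∩ {c₁ + c₂ ≥ m} ∩ PinchedBy ρ Ω`.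

Proof: barrier lemma `minOverSet_nonneg_of_deriv` (`HamiltonODEMinBarrier.lean`) for
`G(t) = H e^{Pt} √((wᵀAw + ρ)(zᵀCz + ρ)) - uᵀBv` over `unitSet⁴`, with the pointwise bounds
of `PinchingEstimatesSingularCore.lean` at the extremal vectors (`singular_upper`,
`rayleighMin_lower`, `singular_scalar`).

## References

* R. S. Hamilton, Comm. Anal. Geom. 5 (1997), §2.1, Thm. 1.9 and its proof (pp. 12–13). [Hamilton1997]
* R. S. Hamilton, J. Differential Geom. 24 (1986), §3 (Lemmas 3.1, 3.5). [Hamilton1986]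
-/

noncomputable section

open Set Real Filter
open scoped Matrix BigOperators Topology

namespace Literature.Geometry.Riemannian

namespace HamiltonODE

/-- The parameter space `unitSet⁴`, `q = ((u, v), (w, z))`. [folklore] -/
abbrev QQ : Type := UU × UU

/-- The parameter set. [folklore] -/
def unitSet4 : Set QQ := (unitSet ×ˢ unitSet) ×ˢ (unitSet ×ˢ unitSet)

/-- The parameter set is compact. [folklore] -/
theorem isCompact_unitSet4 : IsCompact unitSet4 :=
  (isCompact_unitSet.prod isCompact_unitSet).prod (isCompact_unitSet.prod isCompact_unitSet)

/-- The parameter set is nonempty. [folklore] -/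
theorem unitSet4_nonempty : unitSet4.Nonempty :=
  (unitSet_nonempty.prod unitSet_nonempty).prod (unitSet_nonempty.prod unitSet_nonempty)

/-- Hamilton's Thm. 1.9 functional `G = H e^{Pt} √((wᵀAw + ρ)(zᵀCz + ρ)) - uᵀBv`. [folklore] -/
def singularG (H P ρ t : ℝ) (p : Blocks) (q : QQ) : ℝ :=
  H * exp (P * t) * sqrt ((q.2.1 ⬝ᵥ (p.1 *ᵥ q.2.1) + ρ) * (q.2.2 ⬝ᵥ (p.2.2 *ᵥ q.2.2) + ρ)) -
    q.1.1 ⬝ᵥ (p.2.1 *ᵥ q.1.2)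

/-- Its time derivative along a curve with velocity `p'`, in closed form. [folklore] -/
def singularG' (H P ρ t : ℝ) (p p' : Blocks) (q : QQ) : ℝ :=
  H * P * exp (P * t) * sqrt ((q.2.1 ⬝ᵥ (p.1 *ᵥ q.2.1) + ρ) * (q.2.2 ⬝ᵥ (p.2.2 *ᵥ q.2.2) + ρ)) +
    H * exp (P * t) * (((q.2.1 ⬝ᵥ (p'.1 *ᵥ q.2.1)) * (q.2.2 ⬝ᵥ (p.2.2 *ᵥ q.2.2) + ρ) +
      (q.2.1 ⬝ᵥ (p.1 *ᵥ q.2.1) + ρ) * (q.2.2 ⬝ᵥ (p'.2.2 *ᵥ q.2.2))) /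
      (2 * sqrt ((q.2.1 ⬝ᵥ (p.1 *ᵥ q.2.1) + ρ) * (q.2.2 ⬝ᵥ (p.2.2 *ᵥ q.2.2) + ρ)))) -
    q.1.1 ⬝ᵥ (p'.2.1 *ᵥ q.1.2)

/-- `b₃ ≤ H e^{Pt} √((a₁ + ρ)(c₁ + ρ))` iff `G ≥ 0` on `unitSet⁴`. [folklore] -/
theorem singularValueLEExp_iff (H P ρ t : ℝ) (p : Blocks) :
    SingularValueLEExp p H P ρ t ↔ ∀ q ∈ unitSet4, 0 ≤ singularG H P ρ t p q := by
  constructor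
  · rintro h ⟨⟨u, v⟩, ⟨w, z⟩⟩ ⟨⟨hu, hv⟩, ⟨hw, hz⟩⟩
    have := h u v w z hu hv hw hz
    simp only [singularG]; linarith
  · intro h u v w z hu hv hw hz
    have := h ((u, v), (w, z)) ⟨⟨hu, hv⟩, ⟨hw, hz⟩⟩
    simp only [singularG] at this; linarith

/-! ### Calculus -/

/-- Derivative of `G` along a differentiable curve of blocks. [folklore] -/
theorem hasDerivAt_singularG (H P ρ : ℝ) {γ : ℝ → Blocks} {γ' : Blocks} {s : ℝ}
    (hγ : HasDerivAt γ γ' s) (q : QQ)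
    (hpos : (q.2.1 ⬝ᵥ ((γ s).1 *ᵥ q.2.1) + ρ) * (q.2.2 ⬝ᵥ ((γ s).2.2 *ᵥ q.2.2) + ρ) ≠ 0) :
    _root_.HasDerivAt (fun t ↦ singularG H P ρ t (γ t) q) (singularG' H P ρ s (γ s) γ' q) s := by
  have hE : _root_.HasDerivAt (fun t ↦ H * exp (P * t)) (H * P * exp (P * s)) s := by
    have h := ((hasDerivAt_id s).const_mul P).exp.const_mul H
    refine h.congr_deriv ?_
    simp only [id, mul_one]; ring
  have hX : _root_.HasDerivAt (fun t ↦ q.2.1 ⬝ᵥ ((γ t).1 *ᵥ q.2.1) + ρ)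
      (q.2.1 ⬝ᵥ (γ'.1 *ᵥ q.2.1)) s := (hasDerivAt_quadForm hγ.1 _ _).add_const ρ
  have hZ : _root_.HasDerivAt (fun t ↦ q.2.2 ⬝ᵥ ((γ t).2.2 *ᵥ q.2.2) + ρ)
      (q.2.2 ⬝ᵥ (γ'.2.2 *ᵥ q.2.2)) s := (hasDerivAt_quadForm hγ.2.2 _ _).add_const ρ
  have hF := (hX.mul hZ).sqrt hpos
  have hY : _root_.HasDerivAt (fun t ↦ q.1.1 ⬝ᵥ ((γ t).2.1 *ᵥ q.1.2)) (q.1.1 ⬝ᵥ (γ'.2.1 *ᵥ q.1.2)) s :=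
    hasDerivAt_quadForm hγ.2.1 _ _
  have h := (hE.mul hF).sub hY
  refine h.congr_deriv ?_
  simp only [singularG', Pi.mul_apply]
  try ring

/-- `(t, p, q) ↦ G` is continuous. [folklore] -/
theorem continuous_singularG (H P ρ : ℝ) :
    Continuous fun z : ℝ × Blocks × QQ ↦ singularG H P ρ z.1 z.2.1 z.2.2 := by
  unfold singularG
  have hq := continuous_quadForm
  have ht : Continuous fun z : ℝ × Blocks × QQ ↦ z.1 := continuous_fst
  have hA : Continuous fun z : ℝ × Blocks × QQ ↦ z.2.1.1 := continuous_fst.comp (continuous_fst.comp continuous_snd)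
  have hB : Continuous fun z : ℝ × Blocks × QQ ↦ z.2.1.2.1 :=
    continuous_fst.comp (continuous_snd.comp (continuous_fst.comp continuous_snd))
  have hC : Continuous fun z : ℝ × Blocks × QQ ↦ z.2.1.2.2 :=
    continuous_snd.comp (continuous_snd.comp (continuous_fst.comp continuous_snd))
  have hQ : Continuous fun z : ℝ × Blocks × QQ ↦ z.2.2 := continuous_snd.comp continuous_snd
  have hu : Continuous fun z : ℝ × Blocks × QQ ↦ z.2.2.1.1 := continuous_fst.comp (continuous_fst.comp hQ)
  have hv : Continuous fun z : ℝ × Blocks × QQ ↦ z.2.2.1.2 := continuous_snd.comp (continuous_fst.comp hQ)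
  have hw : Continuous fun z : ℝ × Blocks × QQ ↦ z.2.2.2.1 := continuous_fst.comp (continuous_snd.comp hQ)
  have hz : Continuous fun z : ℝ × Blocks × QQ ↦ z.2.2.2.2 := continuous_snd.comp (continuous_snd.comp hQ)
  exact ((continuous_const.mul (continuous_exp.comp (continuous_const.mul ht))).mul
    (continuous_sqrt.comp (((hq.comp (hA.prodMk (hw.prodMk hw))).add continuous_const).mul
      ((hq.comp (hC.prodMk (hz.prodMk hz))).add continuous_const)))).sub
    (hq.comp (hB.prodMk (hu.prodMk hv)))

/-- `(t, p, p', q) ↦ G'` is continuous where `(wᵀAw + ρ)(zᵀCz + ρ) > 0`. [folklore] -/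
theorem continuousOn_singularG' (H P ρ : ℝ) :
    ContinuousOn (fun z : ℝ × Blocks × Blocks × QQ ↦ singularG' H P ρ z.1 z.2.1 z.2.2.1 z.2.2.2)
      {z | 0 < (z.2.2.2.2.1 ⬝ᵥ (z.2.1.1 *ᵥ z.2.2.2.2.1) + ρ) *
        (z.2.2.2.2.2 ⬝ᵥ (z.2.1.2.2 *ᵥ z.2.2.2.2.2) + ρ)} := by
  unfold singularG'
  have hq := continuous_quadForm
  have ht : Continuous fun z : ℝ × Blocks × Blocks × QQ ↦ z.1 := continuous_fst
  have hp : Continuous fun z : ℝ × Blocks × Blocks × QQ ↦ z.2.1 := continuous_fst.comp continuous_snd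
  have hp' : Continuous fun z : ℝ × Blocks × Blocks × QQ ↦ z.2.2.1 :=
    continuous_fst.comp (continuous_snd.comp continuous_snd)
  have hQ : Continuous fun z : ℝ × Blocks × Blocks × QQ ↦ z.2.2.2 :=
    continuous_snd.comp (continuous_snd.comp continuous_snd)
  have hA := continuous_fst.comp hp
  have hC := continuous_snd.comp (continuous_snd.comp hp)
  have hA' := continuous_fst.comp hp'
  have hB' := continuous_fst.comp (continuous_snd.comp hp')
  have hC' := continuous_snd.comp (continuous_snd.comp hp')
  have hu := continuous_fst.comp (continuous_fst.comp hQ)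
  have hv := continuous_snd.comp (continuous_fst.comp hQ)
  have hw := continuous_fst.comp (continuous_snd.comp hQ)
  have hz := continuous_snd.comp (continuous_snd.comp hQ)
  have hX : Continuous fun z : ℝ × Blocks × Blocks × QQ ↦ z.2.2.2.2.1 ⬝ᵥ (z.2.1.1 *ᵥ z.2.2.2.2.1) + ρ :=
    (hq.comp (hA.prodMk (hw.prodMk hw))).add continuous_const
  have hZ : Continuous fun z : ℝ × Blocks × Blocks × QQ ↦ z.2.2.2.2.2 ⬝ᵥ (z.2.1.2.2 *ᵥ z.2.2.2.2.2) + ρ :=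
    (hq.comp (hC.prodMk (hz.prodMk hz))).add continuous_const
  have hX' : Continuous fun z : ℝ × Blocks × Blocks × QQ ↦ z.2.2.2.2.1 ⬝ᵥ (z.2.2.1.1 *ᵥ z.2.2.2.2.1) :=
    hq.comp (hA'.prodMk (hw.prodMk hw))
  have hZ' : Continuous fun z : ℝ × Blocks × Blocks × QQ ↦ z.2.2.2.2.2 ⬝ᵥ (z.2.2.1.2.2 *ᵥ z.2.2.2.2.2) :=
    hq.comp (hC'.prodMk (hz.prodMk hz))
  have hY' : Continuous fun z : ℝ × Blocks × Blocks × QQ ↦ z.2.2.2.1.1 ⬝ᵥ (z.2.2.1.2.1 *ᵥ z.2.2.2.1.2) :=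
    hq.comp (hB'.prodMk (hu.prodMk hv))
  have hE : Continuous fun z : ℝ × Blocks × Blocks × QQ ↦ H * exp (P * z.1) :=
    continuous_const.mul (continuous_exp.comp (continuous_const.mul ht))
  have hF : Continuous fun z : ℝ × Blocks × Blocks × QQ ↦
      sqrt ((z.2.2.2.2.1 ⬝ᵥ (z.2.1.1 *ᵥ z.2.2.2.2.1) + ρ) *
        (z.2.2.2.2.2 ⬝ᵥ (z.2.1.2.2 *ᵥ z.2.2.2.2.2) + ρ)) := continuous_sqrt.comp (hX.mul hZ)
  have hE' : Continuous fun z : ℝ × Blocks × Blocks × QQ ↦ H * P * exp (P * z.1) :=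
    continuous_const.mul (continuous_exp.comp (continuous_const.mul ht))
  have hquot : ContinuousOn (fun z : ℝ × Blocks × Blocks × QQ ↦
      ((z.2.2.2.2.1 ⬝ᵥ (z.2.2.1.1 *ᵥ z.2.2.2.2.1)) * (z.2.2.2.2.2 ⬝ᵥ (z.2.1.2.2 *ᵥ z.2.2.2.2.2) + ρ) +
        (z.2.2.2.2.1 ⬝ᵥ (z.2.1.1 *ᵥ z.2.2.2.2.1) + ρ) * (z.2.2.2.2.2 ⬝ᵥ (z.2.2.1.2.2 *ᵥ z.2.2.2.2.2))) /
      (2 * sqrt ((z.2.2.2.2.1 ⬝ᵥ (z.2.1.1 *ᵥ z.2.2.2.2.1) + ρ) *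
        (z.2.2.2.2.2 ⬝ᵥ (z.2.1.2.2 *ᵥ z.2.2.2.2.2) + ρ))))
      {z | 0 < (z.2.2.2.2.1 ⬝ᵥ (z.2.1.1 *ᵥ z.2.2.2.2.1) + ρ) *
        (z.2.2.2.2.2 ⬝ᵥ (z.2.1.2.2 *ᵥ z.2.2.2.2.2) + ρ)} :=
    ((hX'.mul hZ).add (hX.mul hZ')).continuousOn.div (continuous_const.mul hF).continuousOn
      fun x hx ↦ mul_ne_zero two_ne_zero (Real.sqrt_pos.2 hx).ne'
  exact ((hE'.mul hF).continuousOn.add (hE.continuousOn.mul hquot)).sub hY'.continuousOn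

/-! ### The sign condition at a minimiser -/

/-- Continuity of the Rayleigh quotient. [folklore] -/
theorem continuous_rayleigh (M : Matrix (Fin 3) (Fin 3) ℝ) : Continuous fun z : Fin 3 → ℝ ↦ z ⬝ᵥ (M *ᵥ z) :=
  continuous_id.dotProduct (continuous_const.matrix_mulVec continuous_id)

/-- A maximiser of the Rayleigh quotient over the unit sphere exists. [folklore] -/
theorem exists_rayleigh_max (M : Matrix (Fin 3) (Fin 3) ℝ) :
    ∃ u₃ ∈ unitSet, ∀ z ∈ unitSet, z ⬝ᵥ (M *ᵥ z) ≤ u₃ ⬝ᵥ (M *ᵥ u₃) :=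
  isCompact_unitSet.exists_isMaxOn unitSet_nonempty (continuous_rayleigh M).continuousOn

/-- `√(|q|²)` is bounded by `L ≥ 0` when the values `u·Nv` are. [folklore] -/
theorem sqrt_normSq_le {N : Matrix (Fin 3) (Fin 3) ℝ} {u : Fin 3 → ℝ} {L : ℝ} (hL : 0 ≤ L)
    (h : ∀ v : Fin 3 → ℝ, v ⬝ᵥ v = 1 → u ⬝ᵥ (N *ᵥ v) ≤ L) :
    ((Nᵀ *ᵥ u) ⬝ᵥ (Nᵀ *ᵥ u)).sqrt ≤ L := by
  have h1 := Real.sqrt_le_sqrt (normSq_mulTranspose_le_sq_of_bound hL h)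
  rwa [Real.sqrt_sq hL] at h1

/-- **The sign condition at a minimiser of `G`** (pointwise, Hamilton 1997, Thm. 1.9): with the
constraint data at one time and `R ≥ Σ|A_{kl}| + Σ|C_{kl}|`, if `G ≤ 0` at a minimiser then
`C · G ≤ G'` for `C = 4Ω(R + ρ)`. [cite: Hamilton1997, §2.1, Thm. 1.9 (proof, pp. 12–13)] -/
theorem singular_sign {H P ρ Ω m R s : ℝ} (hH : 0 < H) (hρ : 0 < ρ) (hΩ : 0 < Ω) (hP : 4 * Ω * ρ ≤ P)
    (hm : 0 < m) {p : Blocks} (hA : p.1.IsSymm) (hC : p.2.2.IsSymm)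
    (h12A : p.1.TwoSmallestEigenvaluesSumGE m) (h12C : p.2.2.TwoSmallestEigenvaluesSumGE m)
    (hPB : Matrix.PinchedBy p.1 p.2.1 p.2.2 ρ Ω)
    (hR : (∑ k, ∑ l, |p.1 k l|) + ∑ k, ∑ l, |p.2.2 k l| ≤ R)
    {q : QQ} (hq : q ∈ unitSet4) (hqmin : IsMinOn (singularG H P ρ s p) unitSet4 q)
    (hG0 : singularG H P ρ s p q ≤ 0) :
    4 * Ω * (R + ρ) * singularG H P ρ s p q ≤ singularG' H P ρ s p (field p) q := by
  obtain ⟨⟨u, v⟩, ⟨w, z⟩⟩ := q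
  obtain ⟨⟨hu, hv⟩, ⟨hw, hz⟩⟩ := hq
  obtain ⟨A, B, C⟩ := p
  simp only at hA hC h12A h12C hPB hR hqmin hG0 ⊢
  -- positivity
  have hX : 0 < w ⬝ᵥ (A *ᵥ w) + ρ := (hPB.1 w hw).1
  have hZ : 0 < z ⬝ᵥ (C *ᵥ z) + ρ := (hPB.1 z hz).2
  have hE : 0 < H * exp (P * s) := mul_pos hH (exp_pos _)
  set F := sqrt ((w ⬝ᵥ (A *ᵥ w) + ρ) * (z ⬝ᵥ (C *ᵥ z) + ρ)) with hFdef
  have hF2 : F ^ 2 = (w ⬝ᵥ (A *ᵥ w) + ρ) * (z ⬝ᵥ (C *ᵥ z) + ρ) := Real.sq_sqrt (mul_pos hX hZ).le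
  have hF0 : 0 < F := Real.sqrt_pos.2 (mul_pos hX hZ)
  have hG0' : H * exp (P * s) * F - u ⬝ᵥ (B *ᵥ v) ≤ 0 := hG0
  have hY : 0 < u ⬝ᵥ (B *ᵥ v) := by nlinarith [mul_pos hE hF0]
  -- decoupling
  have hmaxB : ∀ u' v' : Fin 3 → ℝ, u' ⬝ᵥ u' = 1 → v' ⬝ᵥ v' = 1 →
      u' ⬝ᵥ (B *ᵥ v') ≤ u ⬝ᵥ (B *ᵥ v) := by
    intro u' v' hu' hv'
    have h := hqmin (show ((u', v'), (w, z)) ∈ unitSet4 from ⟨⟨hu', hv'⟩, ⟨hw, hz⟩⟩)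
    simp only [mem_setOf_eq, singularG] at h
    linarith
  have hminA : ∀ w' ∈ unitSet, w ⬝ᵥ (A *ᵥ w) ≤ w' ⬝ᵥ (A *ᵥ w') := by
    intro w' hw'
    have h := hqmin (show ((u, v), (w', z)) ∈ unitSet4 from ⟨⟨hu, hv⟩, ⟨hw', hz⟩⟩)
    simp only [mem_setOf_eq, singularG] at h
    have hX' : 0 < w' ⬝ᵥ (A *ᵥ w') + ρ := (hPB.1 w' hw').1
    have h1 : F ≤ sqrt ((w' ⬝ᵥ (A *ᵥ w') + ρ) * (z ⬝ᵥ (C *ᵥ z) + ρ)) := by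
      by_contra hcon
      rw [not_le] at hcon
      nlinarith [mul_lt_mul_of_pos_left hcon hE]
    have h2 := Real.sqrt_le_sqrt_iff (mul_pos hX' hZ).le |>.1 h1
    nlinarith
  have hminC : ∀ z' ∈ unitSet, z ⬝ᵥ (C *ᵥ z) ≤ z' ⬝ᵥ (C *ᵥ z') := by
    intro z' hz'
    have h := hqmin (show ((u, v), (w, z')) ∈ unitSet4 from ⟨⟨hu, hv⟩, ⟨hw, hz'⟩⟩)
    simp only [mem_setOf_eq, singularG] at h
    have hZ' : 0 < z' ⬝ᵥ (C *ᵥ z') + ρ := (hPB.1 z' hz').2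
    have h1 : F ≤ sqrt ((w ⬝ᵥ (A *ᵥ w) + ρ) * (z' ⬝ᵥ (C *ᵥ z') + ρ)) := by
      by_contra hcon
      rw [not_le] at hcon
      nlinarith [mul_lt_mul_of_pos_left hcon hE]
    have h2 := Real.sqrt_le_sqrt_iff (mul_pos hX hZ').le |>.1 h1
    nlinarith
  -- maximisers of the Rayleigh quotients
  obtain ⟨u₃, hu₃, hMA⟩ := exists_rayleigh_max A
  obtain ⟨z₃, hz₃, hMC⟩ := exists_rayleigh_max C
  -- the three differential bounds
  have hup := singular_upper (A := A) (C := C) hu hv hw hz hmaxB hY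
  have hY' : u ⬝ᵥ ((A * B + B * C + (2 : ℝ) • B.sharp) *ᵥ v) ≤ (u ⬝ᵥ (B *ᵥ v)) *
      (u₃ ⬝ᵥ (A *ᵥ u₃) + z₃ ⬝ᵥ (C *ᵥ z₃) + ((Bᵀ *ᵥ w) ⬝ᵥ (Bᵀ *ᵥ w)).sqrt +
        ((B *ᵥ z) ⬝ᵥ (B *ᵥ z)).sqrt) := by
    refine hup.trans (mul_le_mul_of_nonneg_left ?_ hY.le)
    linarith [hMA u hu, hMC v hv]
  have hX' := rayleighMin_lower (B := B) hA hm h12A hw hu₃ hminA hMA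
  have hZ'0 := rayleighMin_lower (B := Bᵀ) hC hm h12C hz hz₃ hminC hMC
  rw [Matrix.transpose_transpose] at hZ'0
  -- bounds by `Ω`
  have hMAΩ : u₃ ⬝ᵥ (A *ᵥ u₃) ≤ Ω * (w ⬝ᵥ (A *ᵥ w) + ρ) := (hPB.2 u₃ v w hu₃ hv hw).1.1
  have hMCΩ : z₃ ⬝ᵥ (C *ᵥ z₃) ≤ Ω * (z ⬝ᵥ (C *ᵥ z) + ρ) := (hPB.2 z₃ v z hz₃ hv hz).2.2.2
  have hβ : ((Bᵀ *ᵥ w) ⬝ᵥ (Bᵀ *ᵥ w)).sqrt ≤ Ω * (w ⬝ᵥ (A *ᵥ w) + ρ) :=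
    sqrt_normSq_le (by positivity) fun v' hv' ↦ (hPB.2 w v' w hw hv' hw).1.2.1
  have hβ' : ((B *ᵥ z) ⬝ᵥ (B *ᵥ z)).sqrt ≤ Ω * (z ⬝ᵥ (C *ᵥ z) + ρ) := by
    have h := sqrt_normSq_le (N := Bᵀ) (u := z) (L := Ω * (z ⬝ᵥ (C *ᵥ z) + ρ)) (by positivity)
      fun v' hv' ↦ by
        rw [Matrix.dotProduct_transpose_mulVec]
        exact (hPB.2 v' z z hv' hz hz).2.2.1
    rwa [Matrix.transpose_transpose] at h
  -- Hamilton's bookkeeping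
  have key := singular_scalar (Y := u ⬝ᵥ (B *ᵥ v)) hρ hP hE hX hZ hF2 hF0 hY' hX' hZ'0 hMAΩ hβ hMCΩ hβ'
  -- compare the constants: `S ≤ 4Ω(R + ρ)` and `G ≤ 0`
  have hS : u₃ ⬝ᵥ (A *ᵥ u₃) + z₃ ⬝ᵥ (C *ᵥ z₃) + ((Bᵀ *ᵥ w) ⬝ᵥ (Bᵀ *ᵥ w)).sqrt +
      ((B *ᵥ z) ⬝ᵥ (B *ᵥ z)).sqrt ≤ 4 * Ω * (R + ρ) := by
    have hAnn : 0 ≤ ∑ k, ∑ l, |A k l| :=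
      Finset.sum_nonneg fun k _ ↦ Finset.sum_nonneg fun l _ ↦ abs_nonneg (A k l)
    have hCnn : 0 ≤ ∑ k, ∑ l, |C k l| :=
      Finset.sum_nonneg fun k _ ↦ Finset.sum_nonneg fun l _ ↦ abs_nonneg (C k l)
    have h1 := (abs_le.1 ((abs_quad_le_sum A hw).trans (by linarith : ∑ k, ∑ l, |A k l| ≤ R))).2
    have h2 := (abs_le.1 ((abs_quad_le_sum C hz).trans (by linarith : ∑ k, ∑ l, |C k l| ≤ R))).2
    nlinarith
  have hGle : singularG H P ρ s (A, B, C) ((u, v), (w, z)) ≤ 0 := hG0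
  have hfin : 4 * Ω * (R + ρ) * singularG H P ρ s (A, B, C) ((u, v), (w, z)) ≤
      (u₃ ⬝ᵥ (A *ᵥ u₃) + z₃ ⬝ᵥ (C *ᵥ z₃) + ((Bᵀ *ᵥ w) ⬝ᵥ (Bᵀ *ᵥ w)).sqrt +
        ((B *ᵥ z) ⬝ᵥ (B *ᵥ z)).sqrt) * singularG H P ρ s (A, B, C) ((u, v), (w, z)) :=
    mul_le_mul_of_nonpos_right hS hGle
  refine hfin.trans ?_
  have eG : singularG H P ρ s (A, B, C) ((u, v), (w, z)) = H * exp (P * s) * F - u ⬝ᵥ (B *ᵥ v) := rfl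
  have eG' : singularG' H P ρ s (A, B, C) (field (A, B, C)) ((u, v), (w, z)) =
      H * exp (P * s) * P * F + H * exp (P * s) *
        ((w ⬝ᵥ ((A * A + B * Bᵀ + (2 : ℝ) • A.sharp) *ᵥ w) * (z ⬝ᵥ (C *ᵥ z) + ρ) +
          (w ⬝ᵥ (A *ᵥ w) + ρ) * (z ⬝ᵥ ((C * C + Bᵀ * B + (2 : ℝ) • C.sharp) *ᵥ z))) / (2 * F)) -
        u ⬝ᵥ ((A * B + B * C + (2 : ℝ) • B.sharp) *ᵥ v) := by
    simp only [singularG', field]; ring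
  rw [eG, eG']
  linarith [key]

/-! ### Thm. 1.9, ODE part -/

attribute [local irreducible] singularG in
/-- Joint continuity of `G` along a continuous curve of blocks. [folklore] -/
theorem continuousOn_singularG_family (H P ρ : ℝ) {γ : ℝ → Blocks} {S : Set ℝ}
    (hγ : ContinuousOn γ S) (K : Set QQ) :
    ContinuousOn (fun z : ℝ × QQ ↦ singularG H P ρ z.1 (γ z.1) z.2) (S ×ˢ K) := by
  have h1 : ContinuousOn (fun z : ℝ × QQ ↦ γ z.1) (S ×ˢ K) :=
    hγ.comp continuousOn_fst fun z hz ↦ (Set.mem_prod.1 hz).1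
  have h2 : ContinuousOn (fun z : ℝ × QQ ↦ (z.1, γ z.1, z.2)) (S ×ˢ K) :=
    continuousOn_fst.prodMk (h1.prodMk continuousOn_snd)
  exact (continuous_singularG H P ρ).continuousOn.comp h2 (Set.mapsTo_univ _ _)

attribute [local irreducible] singularG' in
/-- Joint continuity of `G'` along a continuous solution whose blocks stay pinched. [folklore] -/
theorem continuousOn_singularG'_family (H P ρ : ℝ) {γ : ℝ → Blocks} {S : Set ℝ}
    (hγ : ContinuousOn γ S)
    (hpos : ∀ s ∈ S, ∀ w z : Fin 3 → ℝ, w ⬝ᵥ w = 1 → z ⬝ᵥ z = 1 →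
      0 < (w ⬝ᵥ ((γ s).1 *ᵥ w) + ρ) * (z ⬝ᵥ ((γ s).2.2 *ᵥ z) + ρ)) :
    ContinuousOn (fun z : ℝ × QQ ↦ singularG' H P ρ z.1 (γ z.1) (field (γ z.1)) z.2)
      (S ×ˢ unitSet4) := by
  have h1 : ContinuousOn (fun z : ℝ × QQ ↦ γ z.1) (S ×ˢ unitSet4) :=
    hγ.comp continuousOn_fst fun z hz ↦ (Set.mem_prod.1 hz).1
  have h2 : ContinuousOn (fun z : ℝ × QQ ↦ (z.1, γ z.1, field (γ z.1), z.2)) (S ×ˢ unitSet4) :=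
    continuousOn_fst.prodMk (h1.prodMk ((continuous_field.comp_continuousOn h1).prodMk
      continuousOn_snd))
  refine (continuousOn_singularG' H P ρ).comp h2 fun z hz ↦ ?_
  obtain ⟨hs, ⟨-, ⟨hw, hzz⟩⟩⟩ := Set.mem_prod.1 hz
  exact hpos z.1 hs _ _ hw hzz

/-- **Hamilton 1997, Thm. 1.9, ODE part (proved)** — exactly the Thm. 1.9 hypothesis of
`hamilton_chenZhu_pinching_of_ode₆` (`PinchingEstimatesReduction2.lean`): for `0 < m, ρ, Ω, H`
and `4Ωρ ≤ P`, the family `{b₃ ≤ H e^{Pt} √((a₁ + ρ)(c₁ + ρ))}` is forward invariant under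
Hamilton's ODE relative to `{A, C symmetric} ∩ {a₁ + a₂ ≥ m} ∩ {c₁ + c₂ ≥ m} ∩ PinchedBy ρ Ω`.
[cite: Hamilton1997, §2.1, Thm. 1.9 (pp. 12–13)] -/
theorem hamilton1997_B19_ode : ∀ m ρ Ω P H : ℝ, 0 < m → 0 < ρ → 0 < Ω → 4 * Ω * ρ ≤ P → 0 < H →
    IsInvariantRel field
      (fun _ ↦ {p : Blocks | (p.1.IsSymm ∧ p.2.2.IsSymm) ∧ p.1.TwoSmallestEigenvaluesSumGE m ∧
        p.2.2.TwoSmallestEigenvaluesSumGE m ∧ Matrix.PinchedBy p.1 p.2.1 p.2.2 ρ Ω})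
      (fun t ↦ {p | SingularValueLEExp p H P ρ t}) := by
  intro m ρ Ω P H hm hρ hΩ hP hH γ t₀ t₁ _ h₁ hγ hK hin
  have hγc := IsSolutionOn.continuousOn hγ
  have hpos : ∀ s ∈ Icc t₀ t₁, ∀ w z : Fin 3 → ℝ, w ⬝ᵥ w = 1 → z ⬝ᵥ z = 1 →
      0 < (w ⬝ᵥ ((γ s).1 *ᵥ w) + ρ) * (z ⬝ᵥ ((γ s).2.2 *ᵥ z) + ρ) := fun s hs w z hw hz ↦
    mul_pos ((hK s hs).2.2.2.1 w hw).1 ((hK s hs).2.2.2.1 z hz).2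
  have hGc := continuousOn_singularG_family H P ρ hγc unitSet4
  have hG'c := continuousOn_singularG'_family H P ρ hγc hpos
  have hGd : ∀ q ∈ unitSet4, ∀ s ∈ Icc t₀ t₁, _root_.HasDerivAt (fun t ↦ singularG H P ρ t (γ t) q)
      (singularG' H P ρ s (γ s) (field (γ s)) q) s := fun q hq s hs ↦
    hasDerivAt_singularG H P ρ (hγ s hs) q (hpos s hs _ _ hq.2.1 hq.2.2).ne'
  -- uniform bound `R` for `Σ|A| + Σ|C|`
  have hScont : ContinuousOn (fun t ↦ (∑ k, ∑ l, |(γ t).1 k l|) + ∑ k, ∑ l, |(γ t).2.2 k l|)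
      (Icc t₀ t₁) := by
    have hA : ContinuousOn (fun t ↦ (γ t).1) (Icc t₀ t₁) := continuousOn_fst.comp hγc (mapsTo_univ _ _)
    have hC : ContinuousOn (fun t ↦ (γ t).2.2) (Icc t₀ t₁) :=
      (continuousOn_snd.comp continuousOn_snd (mapsTo_univ _ _)).comp hγc (mapsTo_univ _ _)
    exact (continuousOn_finsetSum _ fun k _ ↦ continuousOn_finsetSum _ fun l _ ↦
      ((continuousOn_pi.1 (continuousOn_pi.1 hA k) l)).abs).add
      (continuousOn_finsetSum _ fun k _ ↦ continuousOn_finsetSum _ fun l _ ↦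
      ((continuousOn_pi.1 (continuousOn_pi.1 hC k) l)).abs)
  obtain ⟨sR, -, hR⟩ := isCompact_Icc.exists_isMaxOn (nonempty_Icc.2 h₁) hScont
  set R := (∑ k, ∑ l, |(γ sR).1 k l|) + ∑ k, ∑ l, |(γ sR).2.2 k l| with hRdef
  have hR' : ∀ s ∈ Icc t₀ t₁, (∑ k, ∑ l, |(γ s).1 k l|) + ∑ k, ∑ l, |(γ s).2.2 k l| ≤ R :=
    fun s hs ↦ hR hs
  have hR0 : 0 ≤ R := by positivity
  have hC0 : 0 ≤ 4 * Ω * (R + ρ) := by positivity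
  have key := minOverSet_nonneg_of_deriv (G := fun t q ↦ singularG H P ρ t (γ t) q)
    (G' := fun t q ↦ singularG' H P ρ t (γ t) (field (γ t)) q) isCompact_unitSet4 unitSet4_nonempty
    hGc hGd hG'c h₁ one_pos hC0 (η := 1) (fun s hs q hq hqmin _ hG0 ↦ ?_) ?_
  · rw [mem_setOf_eq, singularValueLEExp_iff]
    exact (le_minOverSet_iff isCompact_unitSet4 unitSet4_nonempty (continuousOn_slice
      (G := fun t q ↦ singularG H P ρ t (γ t) q) hGc (right_mem_Icc.2 h₁)) 0).1 key
  · have hsI : s ∈ Icc t₀ t₁ := Ico_subset_Icc_self hs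
    obtain ⟨⟨hA, hC⟩, h12A, h12C, hPB⟩ := hK s hsI
    exact singular_sign hH hρ hΩ hP hm hA hC h12A h12C hPB (hR' s hsI) hq hqmin hG0
  · refine (le_minOverSet_iff isCompact_unitSet4 unitSet4_nonempty (continuousOn_slice
      (G := fun t q ↦ singularG H P ρ t (γ t) q) hGc (left_mem_Icc.2 h₁)) 0).2 ?_
    exact (singularValueLEExp_iff H P ρ t₀ (γ t₀)).1 hin

end HamiltonODE

end Literature.Geometry.Riemannian

end
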